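import Literature.Analysis.FluidPDE.PeriodicCylinderSobolevInequalities
import Literature.Analysis.FunctionSpaces.SobolevNormSmoothMaps
import HarnessLib

/-!
# The Sobolev step of the logarithmic `W^{1,∞}` estimate in the periodic cylinder:
`[curl v]_{C^{0,1/2}({r<1})} ≤ C ‖v‖_{H³(cell)}`

Topic `Literature/Analysis/FluidPDE`. Support file (all results proved, no named facts, no
definitions) for the decomposition of the named fact
`Literature.Analysis.FluidPDE.ShirotaYanagisawa1993_periodicCylinderLogDivCurlEstimate`
(`Ferrari1993LogEstimateReduction.lean`; Shirota–Yanagisawa 1993, proof of (15), pp. 80–81;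
Ferrari 1993, Prop. 1, p. 286; Beale–Kato–Majda 1984). In the printed proofs of the logarithmic
estimate `|∇u|_{L^∞} ≤ C{‖u‖₀ + 1 + (1 + log⁺‖u‖₃)|curl u|_{L^∞}}` the norm `‖u‖₃` enters at exactly
one place: the Hölder seminorm of the vorticity, which controls the near part of the singular
integral, is bounded by **Sobolev's inequality**, `[curl u]_{C^γ} ≤ C ‖u‖_{H³}` (S.–Y. (22): "by
using Sobolev's inequality and Theorem 10.5 in [1]"; Ferrari p. 293: "Using Sobolev's theorem ...
`‖φ‖_{C^β} ≤ c ‖v‖_{W^{2,p}}`"; B.–K.–M. p. 65: `|ω|_{C^γ} ≤ C ‖u‖₃`). This file proves that step in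
the periodic cylinder `{r < 1} × ℝ/Lℤ`, in the tree's rendering:

* `exists_holderOnWith_curl_unitCylinder` — for `L > 0` there is `C` such that for every velocity
  field `v` which is `C^∞` on the closed cylinder `{r ≤ 1}` and `L`-periodic in `z`, and every
  `n ≥ ‖v‖_{H³(cell)}` (`eSobolevDomainNorm 3 2 (cylinderCell L) volume`), the vorticity `curl v` is
  `1/2`-Hölder on the open cylinder `{r < 1}` with constant `C n`
  (`HolderOnWith (C * n) (1/2) (curl v) unitCylinder`).

Proof. (i) `curl v x = Λ(Dv(x))` for a fixed linear map `Λ` (`exists_curl_eq_clm_fderiv`), so on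
`{r < 1}` the vorticity agrees with the map `ω̃ = Λ ∘ D_K v` built from the within-derivative on the
closed cylinder `K`, which is `C^∞` on `K`. (ii) On the open period cell,
`‖ω̃‖_{W^{2,2}} ≤ ‖Λ‖ ‖Dv‖_{W^{2,2}} ≤ ‖Λ‖ C ‖v‖_{W^{3,2}}`
(`eSobolevDomainNorm_clm_comp_le`, `exists_eSobolevDomainNorm_fderiv_le`). (iii) The Sobolev–Morrey
imbedding `W^{2,2}(cell) → C^{0,1/2}` on the bounded convex (hence Lipschitz) cell
(`exists_forall_enorm_sub_le_eSobolevDomainNorm_two`, Adams Thm. 5.4 Part II Case C') bounds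
`‖ω̃(x) - ω̃(y)‖ ≤ K ‖ω̃‖_{W^{2,2}(cell)} ‖x - y‖^{1/2}` on the open cell, and by continuity on its
closure (`holderOnWith_closure_of_continuousOn`). (iv) Periodicity: a pair of points of the infinite
cylinder is translated by a common multiple of `L e_z` so that the lower point lies in
`{0 ≤ z < L}`; if the upper point leaves the closed cell the segment is cut at `z = L` (the cylinder
is convex) and the upper piece is translated down by `L e_z`; pairs more than a period apart are
first brought within a period by translating one point, which does not increase their distance.
The constant doubles.

## Faithfulness / what is NOT here

Nothing is vendored here. The periodic cylinder is the tree's rendering of the bounded domain of the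
printed statements (adaptation caveat as in `Ferrari1993_periodicCylinderH3Bound`); the exponent
`1/2` is the sharp Morrey exponent `2 - 3/2` for `H³ ⊂ C^{1,1/2}` in dimension `3` (B.–K.–M. use any
`0 < γ < 1`, Ferrari any `0 < β < 1`; the logarithm absorbs the choice).

## Mathlib / tree search

Tree: `exists_forall_enorm_sub_le_eSobolevDomainNorm_two` (`SobolevHolderDomain`),
`eSobolevDomainNorm_clm_comp_le`, `exists_eSobolevDomainNorm_fderiv_le`,
`memSobolevDomain_of_contDiffOn`, `holderOnWith_closure_of_continuousOn` (`SobolevNormSmoothMaps`),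
`isLipschitzDomain_cylinderCell`, `isBounded_cylinderCell` (`PeriodicCylinderSobolevInequalities`),
`convex_unitCylinder`,
`uniqueDiffOn_closure_unitCylinder`, `closure_unitCylinder_mem_nhds`, `isCompact_closure_cylinderCell`,
`closure_cylinderCell_subset`, `cylRadius_add_axialShift`, `IsAxiallyPeriodic.add_int_mul`; no Hölder
estimate for `curl` or for the periodic cylinder (`lean search 'HolderOnWith.*curl|holder.*Cylinder'`:
none). From Mathlib: `fderiv_comp_add_right`, `Int.floor_le`, `Int.lt_floor_add_one`,
`Convex.add_smul_sub_mem`, `image_closure_subset_closure_image`, `norm_add_sq_real`,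
`finrank_euclideanSpace_fin`.

## References

* T. Shirota, T. Yanagisawa, Proc. Japan Acad. 69 A (1993) 77–82, proof of (15), (21)–(22) p. 81.
  [ShirotaYanagisawa1993]
* A. B. Ferrari, Comm. Math. Phys. 155 (1993) 277–294, Prop. 1 and its proof, pp. 286–293.
  [Ferrari1993]
* J. T. Beale, T. Kato, A. Majda, Comm. Math. Phys. 94 (1984) 61–66, (13)–(15) p. 65.
* R. A. Adams, *Sobolev Spaces* (1975), Thm. 5.4 Part II Case C'. [Adams1975]
-/

noncomputable section

open MeasureTheory Set Function Filter Topology TopologicalSpace WithLp Metric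
open scoped ContDiff NNReal ENNReal InnerProductSpace RealInnerProductSpace

namespace Literature.Analysis.FluidPDE

open Literature.Analysis.FunctionSpaces

/-! ### The curl through the derivative; periodicity -/

/-- **The curl is a fixed linear function of the derivative**: there is a (continuous) linear map
`Λ : L(ℝ³, ℝ³) → ℝ³` with `curl v x = Λ (Dv(x))` for all `v`, `x` — the components
`(∂₂v₃ − ∂₃v₂, ∂₃v₁ − ∂₁v₃, ∂₁v₂ − ∂₂v₁)` are linear in the matrix `Dv(x)` (Majda–Bertozzi,
*Vorticity and Incompressible Flow*, §1.1 eq. (1.11); the tree's `curl`). [folklore] -/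
theorem exists_curl_eq_clm_fderiv :
    ∃ Λ : ((EuclideanSpace ℝ (Fin 3)) →L[ℝ] (EuclideanSpace ℝ (Fin 3))) →L[ℝ] (EuclideanSpace ℝ (Fin 3)),
      ∀ (v : (EuclideanSpace ℝ (Fin 3)) → (EuclideanSpace ℝ (Fin 3))) (x : (EuclideanSpace ℝ (Fin 3))), curl v x = Λ (fderiv ℝ v x) := by
  let e : Fin 3 → (EuclideanSpace ℝ (Fin 3)) := fun j => EuclideanSpace.single j 1
  let Λₗ : ((EuclideanSpace ℝ (Fin 3)) →L[ℝ] (EuclideanSpace ℝ (Fin 3))) →ₗ[ℝ]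
      (EuclideanSpace ℝ (Fin 3)) :=
    { toFun := fun T => toLp 2 ![T (e 1) 2 - T (e 2) 1, T (e 2) 0 - T (e 0) 2, T (e 0) 1 - T (e 1) 0]
      map_add' := fun T S => by
        ext i
        fin_cases i <;> simp <;> ring
      map_smul' := fun c T => by
        ext i
        fin_cases i <;> simp <;> ring }
  exact ⟨LinearMap.toContinuousLinearMap Λₗ, fun v x => rfl⟩

/-- The axial coordinate of an axial translate: `(x + s e_z)₂ = x₂ + s`. [folklore] -/
theorem apply_two_add_axialShift (x : (EuclideanSpace ℝ (Fin 3))) (s : ℝ) :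
    (x + s • EuclideanSpace.single (2 : Fin 3) (1 : ℝ)) 2 = x 2 + s := by
  simp

/-- An axial translate of a point of the open cylinder lies in the open cylinder (`r` is
unchanged). [folklore] -/
theorem add_axialShift_mem_unitCylinder {x : (EuclideanSpace ℝ (Fin 3))}
    (hx : x ∈ (unitCylinder : Set (EuclideanSpace ℝ (Fin 3)))) (s : ℝ) :
    x + s • EuclideanSpace.single (2 : Fin 3) (1 : ℝ) ∈ (unitCylinder : Set (EuclideanSpace ℝ (Fin 3))) := by
  rw [SetLike.mem_coe, mem_unitCylinder] at hx ⊢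
  rwa [cylRadius_add_axialShift]

/-- The curl of an `L`-periodic field is `L`-periodic (the derivative of `v = v(· + L e_z)` is
`Dv(· + L e_z)`, `fderiv_comp_add_right`; no differentiability needed). [folklore] -/
theorem IsAxiallyPeriodic.curl {L : ℝ} {v : (EuclideanSpace ℝ (Fin 3)) → (EuclideanSpace ℝ (Fin 3))}
    (hv : IsAxiallyPeriodic L v) :
    IsAxiallyPeriodic L (curl v) := by
  obtain ⟨Λ, hΛ⟩ := exists_curl_eq_clm_fderiv
  intro x
  have hfun : v = fun y => v (y + L • EuclideanSpace.single (2 : Fin 3) (1 : ℝ)) :=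
    funext fun y => (hv y).symm
  rw [hΛ, hΛ]
  congr 1
  conv_rhs => rw [hfun]
  rw [fderiv_comp_add_right]

/-! ### The closed period cell -/

/-- Points with `r < 1` and `0 ≤ z ≤ L` lie in the closure of the period cell
`{r < 1} × (0, L)` (`L > 0`): move along the vertical segment through the point. [folklore] -/
theorem mem_closure_cylinderCell {L : ℝ} (hL : 0 < L) {x : (EuclideanSpace ℝ (Fin 3))} (hr : cylRadius x < 1)
    (hz : x 2 ∈ Icc (0 : ℝ) L) : x ∈ closure (cylinderCell L : Set (EuclideanSpace ℝ (Fin 3))) := by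
  set c : ℝ → (EuclideanSpace ℝ (Fin 3)) := fun t => x + (t - x 2) • EuclideanSpace.single (2 : Fin 3) (1 : ℝ)
    with hc_def
  have hc : Continuous c := by
    simp only [hc_def]
    fun_prop
  have hcx : c (x 2) = x := by simp [hc_def]
  have hmem : ∀ t ∈ Ioo (0 : ℝ) L, c t ∈ (cylinderCell L : Set (EuclideanSpace ℝ (Fin 3))) := by
    intro t ht
    rw [SetLike.mem_coe, mem_cylinderCell]
    refine ⟨by rw [hc_def, cylRadius_add_axialShift]; exact hr, ?_⟩
    rw [hc_def, apply_two_add_axialShift]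
    simpa using ht
  have hx2 : x 2 ∈ closure (Ioo (0 : ℝ) L) := by
    rw [closure_Ioo hL.ne]
    exact hz
  have h1 : c (x 2) ∈ closure (c '' Ioo (0 : ℝ) L) :=
    image_closure_subset_closure_image hc ⟨x 2, hx2, rfl⟩
  rw [← hcx]
  exact closure_mono (image_subset_iff.2 fun t ht => hmem t ht) h1

/-! ### The Sobolev–Morrey bound on the closed cell for maps smooth on the closed cylinder -/

/-- **`W^{2,2}(cell) → C^{0,1/2}` on the closed period cell for maps smooth on the closed
cylinder** (Adams, *Sobolev Spaces* (1975), Thm. 5.4 Part II Case C' (9), `m = p = 2`, `n = 3`, via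
`exists_forall_enorm_sub_le_eSobolevDomainNorm_two` on the bounded convex cell): for `L > 0`
there is `K < ∞` such that every `f` of class `C^∞` on `closure {r < 1}` satisfies
`‖f(x) - f(y)‖ ≤ K ‖f‖_{W^{2,2}(cell)} ‖x - y‖^{1/2}` for all `x, y` in the *closed* period cell
(membership `memSobolevDomain_of_contDiffOn`; passage to the closure by continuity,
`holderOnWith_closure_of_continuousOn`, the norm being finite,
`eSobolevDomainNorm_cylinderCell_lt_top`). [cite: Adams1975, Thm. 5.4 Part II Case C' (9) (m = p = 2, n = 3)] -/
theorem exists_forall_enorm_sub_le_H2_closure_cylinderCell {F : Type*} [NormedAddCommGroup F]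
    [NormedSpace ℝ F] [FiniteDimensional ℝ F] (L : ℝ) :
    ∃ K : ℝ≥0∞, K < ⊤ ∧ ∀ f : (EuclideanSpace ℝ (Fin 3)) → F,
      ContDiffOn ℝ ∞ f (closure (unitCylinder : Set (EuclideanSpace ℝ (Fin 3)))) →
      ∀ x ∈ closure (cylinderCell L : Set (EuclideanSpace ℝ (Fin 3))),
        ∀ y ∈ closure (cylinderCell L : Set (EuclideanSpace ℝ (Fin 3))),
        ‖f x - f y‖ₑ ≤ K * eSobolevDomainNorm 2 2 (cylinderCell L) volume f *
          edist x y ^ (1 / 2 : ℝ) := by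
  haveI : CompleteSpace F := FiniteDimensional.complete ℝ F
  have hE : Module.finrank ℝ (EuclideanSpace ℝ (Fin 3)) = 3 := finrank_euclideanSpace_fin
  obtain ⟨K, hK, hcell⟩ := exists_forall_enorm_sub_le_eSobolevDomainNorm_two
    (volume : Measure (EuclideanSpace ℝ (Fin 3)))
    (F := F) hE (isLipschitzDomain_cylinderCell L) (isBounded_cylinderCell L)
  refine ⟨K, hK, fun f hf x hx y hy => ?_⟩
  set N := eSobolevDomainNorm 2 2 (cylinderCell L) volume f with hN
  have hNtop : N < ⊤ := eSobolevDomainNorm_cylinderCell_lt_top L 2 2 hf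
  have hmem : MemSobolevDomain 2 2 (cylinderCell L) volume f :=
    memSobolevDomain_of_contDiffOn uniqueDiffOn_closure_unitCylinder
      (isCompact_closure_cylinderCell L) (closure_cylinderCell_subset L) 2 2 hf
  have hfc : ContinuousOn f (closure (cylinderCell L : Set (EuclideanSpace ℝ (Fin 3)))) :=
    hf.continuousOn.mono (closure_cylinderCell_subset L)
  -- the bound on the open cell as a Hölder condition with a finite constant
  have hKN : K * N ≠ ⊤ := ENNReal.mul_ne_top hK.ne hNtop.ne
  set C : ℝ≥0 := (K * N).toNNReal with hC
  have hCc : (C : ℝ≥0∞) = K * N := ENNReal.coe_toNNReal hKN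
  have hr : ((1 / 2 : ℝ≥0) : ℝ) = 1 / 2 := by norm_num
  have hopen : HolderOnWith C (1 / 2) f (cylinderCell L : Set (EuclideanSpace ℝ (Fin 3))) := by
    intro a ha b hb
    rw [edist_eq_enorm_sub, hCc, hr]
    exact hcell f hmem (hfc.mono subset_closure) a ha b hb
  have hclosed := holderOnWith_closure_of_continuousOn hfc hopen x hx y hy
  rwa [edist_eq_enorm_sub, hCc, hr] at hclosed

/-! ### The vorticity of a field smooth on the closed cylinder: its `W^{2,2}` size on the cell -/

/-- **`‖Λ ∘ D_K v‖_{W^{2,2}(cell)} ≤ ‖Λ‖ C ‖v‖_{W^{3,2}(cell)}`**: for `v` of class `C^∞` on the closed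
cylinder `K`, the map `x ↦ Λ(D_K v(x))` (`D_K` the within-derivative on `K`; for `Λ` the curl map
this is the vorticity on `{r < 1}`) has `W^{2,2}` norm on the open period cell bounded by
`‖Λ‖ C ‖v‖_{W^{3,2}(cell)}`, `C` the constant of `exists_eSobolevDomainNorm_fderiv_le` (on the cell
`D_K v = Dv`; then `eSobolevDomainNorm_clm_comp_le`). [folklore] -/
theorem eSobolevDomainNorm_clm_fderivWithin_le {G : Type*} [NormedAddCommGroup G]
    [NormedSpace ℝ G] [CompleteSpace G] {L : ℝ} {C : ℝ≥0}
    (hC : ∀ (k : ℕ) {φ : (EuclideanSpace ℝ (Fin 3)) → (EuclideanSpace ℝ (Fin 3))},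
      ContDiffOn ℝ ∞ φ (cylinderCell L : Set (EuclideanSpace ℝ (Fin 3))) →
      eSobolevDomainNorm k 2 (cylinderCell L) volume (fderiv ℝ φ) ≤
        C * eSobolevDomainNorm (k + 1) 2 (cylinderCell L) volume φ)
    (Λ : ((EuclideanSpace ℝ (Fin 3)) →L[ℝ] (EuclideanSpace ℝ (Fin 3))) →L[ℝ] G)
    {v : (EuclideanSpace ℝ (Fin 3)) → (EuclideanSpace ℝ (Fin 3))}
    (hv : ContDiffOn ℝ ∞ v (closure (unitCylinder : Set (EuclideanSpace ℝ (Fin 3))))) (k : ℕ) :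
    eSobolevDomainNorm k 2 (cylinderCell L) volume
        (fun x => Λ (fderivWithin ℝ v (closure (unitCylinder : Set (EuclideanSpace ℝ (Fin 3)))) x)) ≤
      ‖Λ‖₊ * (C * eSobolevDomainNorm (k + 1) 2 (cylinderCell L) volume v) := by
  have hsub : (cylinderCell L : Set (EuclideanSpace ℝ (Fin 3))) ⊆
      closure (unitCylinder : Set (EuclideanSpace ℝ (Fin 3))) :=
    subset_closure.trans (closure_cylinderCell_subset L)
  have hvΩ : ContDiffOn ℝ ∞ v (cylinderCell L : Set (EuclideanSpace ℝ (Fin 3))) := hv.mono hsub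
  have hD : ContDiffOn ℝ ∞ (fderiv ℝ v) (cylinderCell L : Set (EuclideanSpace ℝ (Fin 3))) :=
    ((contDiffOn_infty_iff_fderiv_of_isOpen (cylinderCell L).isOpen).1 hvΩ).2
  have heq : EqOn (fun x => Λ (fderivWithin ℝ v (closure (unitCylinder : Set (EuclideanSpace ℝ (Fin 3)))) x))
      (fun x => Λ (fderiv ℝ v x)) (cylinderCell L) := fun x hx => by
    show Λ (fderivWithin ℝ v _ x) = Λ (fderiv ℝ v x)
    rw [fderivWithin_of_mem_nhds (closure_unitCylinder_mem_nhds (cylinderCell_le_unitCylinder L hx))]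
  rw [SobolevApprox.eSobolevDomainNorm_congr heq]
  exact (eSobolevDomainNorm_clm_comp_le Λ k hD).trans (mul_le_mul' le_rfl (hC k hvΩ))

/-! ### The main theorem -/

/-- Squared distance after an admissible axial translation of the upper point: if
`0 ≤ jL ≤ y₂ - x₂` then `‖x - (y - jL e_z)‖ ≤ ‖x - y‖` (expand `‖(x - y) + jL e_z‖²`). [folklore] -/
theorem norm_sub_add_axialShift_le {x y : (EuclideanSpace ℝ (Fin 3))} {s : ℝ} (hs0 : 0 ≤ s)
    (hs : s ≤ y 2 - x 2) :
    ‖x - (y + (-s) • EuclideanSpace.single (2 : Fin 3) (1 : ℝ))‖ ≤ ‖x - y‖ := by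
  have e1 : x - (y + (-s) • EuclideanSpace.single (2 : Fin 3) (1 : ℝ)) =
      (x - y) + s • EuclideanSpace.single (2 : Fin 3) (1 : ℝ) := by
    rw [neg_smul, sub_add_eq_sub_sub, sub_neg_eq_add]
  rw [e1]
  have hn : ∀ z : (EuclideanSpace ℝ (Fin 3)), ‖z‖ ^ 2 = z 0 ^ 2 + z 1 ^ 2 + z 2 ^ 2 := fun z => by
    rw [EuclideanSpace.norm_eq, Real.sq_sqrt (Finset.sum_nonneg fun i _ => sq_nonneg _),
      Fin.sum_univ_three]
    simp only [Real.norm_eq_abs, sq_abs]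
  have hsq : ‖(x - y) + s • EuclideanSpace.single (2 : Fin 3) (1 : ℝ)‖ ^ 2 ≤ ‖x - y‖ ^ 2 := by
    rw [hn, hn]
    have h0 : ((x - y) + s • EuclideanSpace.single (2 : Fin 3) (1 : ℝ)) 0 = (x - y) 0 := by simp
    have h1 : ((x - y) + s • EuclideanSpace.single (2 : Fin 3) (1 : ℝ)) 1 = (x - y) 1 := by simp
    have h2 : ((x - y) + s • EuclideanSpace.single (2 : Fin 3) (1 : ℝ)) 2 = (x 2 - y 2) + s := by simp
    rw [h0, h1, h2]
    have h3 : (x - y) 2 = x 2 - y 2 := by simp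
    rw [h3]
    nlinarith [mul_nonneg hs0 (sub_nonneg.2 hs), mul_nonneg hs0 (hs0.trans hs)]
  exact (pow_le_pow_iff_left₀ (norm_nonneg _) (norm_nonneg _) two_ne_zero).1 hsq

/-- A point on the segment `[a, b]` is no farther from either end than the ends are from each
other, in `edist` form. [folklore] -/
theorem edist_segment_le {a b : (EuclideanSpace ℝ (Fin 3))} {t : ℝ} (ht : t ∈ Icc (0 : ℝ) 1) :
    edist a (a + t • (b - a)) ≤ edist a b ∧ edist (a + t • (b - a)) b ≤ edist a b := by
  have h1 : dist a (a + t • (b - a)) ≤ dist a b := by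
    rw [dist_eq_norm, dist_eq_norm, sub_add_eq_sub_sub, sub_self, zero_sub, norm_neg, norm_smul,
      Real.norm_eq_abs, abs_of_nonneg ht.1, norm_sub_rev]
    exact mul_le_of_le_one_left (norm_nonneg _) ht.2
  have h2 : dist (a + t • (b - a)) b ≤ dist a b := by
    have e : a + t • (b - a) - b = (1 - t) • (a - b) := by
      simp only [sub_smul, one_smul, smul_sub]; abel
    rw [dist_eq_norm, dist_eq_norm, e, norm_smul, Real.norm_eq_abs, abs_of_nonneg (sub_nonneg.2 ht.2)]
    exact mul_le_of_le_one_left (norm_nonneg _) (sub_le_self _ ht.1)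
  simp only [edist_dist]
  exact ⟨ENNReal.ofReal_le_ofReal h1, ENNReal.ofReal_le_ofReal h2⟩

/-- **The vorticity of an `H³` field on the periodic cylinder is `1/2`-Hölder, quantitatively**
(the Sobolev step of Shirota–Yanagisawa 1993, (22) p. 81 / Ferrari 1993, p. 293 / Beale–Kato–Majda
1984, p. 65, `|ω|_{C^γ} ≤ C ‖u‖₃`, in the periodic cylinder): for `L > 0` there is `C` such that for
every `v` of class `C^∞` on the closed cylinder `{r ≤ 1}`, `L`-periodic in `z`, and every
`n ≥ ‖v‖_{H³(cell)}` (`eSobolevDomainNorm 3 2 (cylinderCell L) volume v`), the vorticity satisfies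
`‖curl v (x) - curl v (y)‖ ≤ C n ‖x - y‖^{1/2}` for all `x, y` with `r < 1`. See the module
docstring for the proof (Sobolev–Morrey on the cell, continuity up to the closed cell, periodicity
and convexity to reach all pairs). [cite: ShirotaYanagisawa1993, proof of (15), (21)–(22) p. 81 (Sobolev step)]
[cite: Adams1975, Thm. 5.4 Part II Case C' (9)] -/
theorem exists_holderOnWith_curl_unitCylinder {L : ℝ} (hL : 0 < L) :
    ∃ C : ℝ≥0, ∀ (v : (EuclideanSpace ℝ (Fin 3)) → (EuclideanSpace ℝ (Fin 3))),
      ContDiffOn ℝ ∞ v (closure (unitCylinder : Set (EuclideanSpace ℝ (Fin 3)))) →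
      IsAxiallyPeriodic L v → ∀ n : ℝ≥0, eSobolevDomainNorm 3 2 (cylinderCell L) volume v ≤ n →
        HolderOnWith (C * n) (1 / 2) (curl v) (unitCylinder : Set (EuclideanSpace ℝ (Fin 3))) := by
  -- the fixed data: `Λ`, the Sobolev–Morrey constant `K`, the derivative constant `C₁`
  obtain ⟨Λ, hΛ⟩ := exists_curl_eq_clm_fderiv
  obtain ⟨K, hK, hH2⟩ := exists_forall_enorm_sub_le_H2_closure_cylinderCell (F := (EuclideanSpace ℝ (Fin 3))) L
  obtain ⟨C₁, hC₁⟩ := exists_eSobolevDomainNorm_fderiv_le (E' := (EuclideanSpace ℝ (Fin 3)))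
    (F := (EuclideanSpace ℝ (Fin 3)))
    (μ := (volume : Measure (EuclideanSpace ℝ (Fin 3)))) (Ω := cylinderCell L) (p := 2) one_le_two
  set C₀ : ℝ≥0∞ := K * (‖Λ‖₊ * C₁) with hC₀
  have hC₀top : C₀ ≠ ⊤ := ENNReal.mul_ne_top hK.ne ENNReal.coe_ne_top
  refine ⟨2 * C₀.toNNReal, fun v hv hper n hn => ?_⟩
  -- notation
  set Kc : Set (EuclideanSpace ℝ (Fin 3)) := closure (unitCylinder : Set (EuclideanSpace ℝ (Fin 3))) with hKc
  set ez : (EuclideanSpace ℝ (Fin 3)) := EuclideanSpace.single (2 : Fin 3) (1 : ℝ) with hez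
  set w : (EuclideanSpace ℝ (Fin 3)) → (EuclideanSpace ℝ (Fin 3)) := fun x => Λ (fderivWithin ℝ v Kc x) with hw
  have hws : ContDiffOn ℝ ∞ w Kc :=
    Λ.contDiff.comp_contDiffOn ((contDiffOn_infty_iff_fderivWithin
      uniqueDiffOn_closure_unitCylinder).1 hv).2
  have hcurl : ∀ x ∈ (unitCylinder : Set (EuclideanSpace ℝ (Fin 3))), curl v x = w x := fun x hx => by
    rw [hΛ, hw]
    show Λ (fderiv ℝ v x) = Λ (fderivWithin ℝ v Kc x)
    rw [fderivWithin_of_mem_nhds (closure_unitCylinder_mem_nhds hx)]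
  have hcper : IsAxiallyPeriodic L (curl v) := hper.curl
  -- the Hölder bound for `w` on the closed cell, with constant `M = C₀ n`
  set M : ℝ≥0∞ := C₀ * n with hM
  have hwN : eSobolevDomainNorm 2 2 (cylinderCell L) volume w ≤ ‖Λ‖₊ * (C₁ * n) :=
    (eSobolevDomainNorm_clm_fderivWithin_le hC₁ Λ hv 2).trans (by gcongr)
  have hcell : ∀ x ∈ closure (cylinderCell L : Set (EuclideanSpace ℝ (Fin 3))),
      ∀ y ∈ closure (cylinderCell L : Set (EuclideanSpace ℝ (Fin 3))),
      edist (w x) (w y) ≤ M * edist x y ^ (1 / 2 : ℝ) := by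
    intro x hx y hy
    rw [edist_eq_enorm_sub]
    calc ‖w x - w y‖ₑ ≤ K * eSobolevDomainNorm 2 2 (cylinderCell L) volume w * edist x y ^ (1 / 2 : ℝ) :=
          hH2 w hws x hx y hy
      _ ≤ K * (‖Λ‖₊ * (C₁ * n)) * edist x y ^ (1 / 2 : ℝ) := by gcongr
      _ = M * edist x y ^ (1 / 2 : ℝ) := by rw [hM, hC₀]; ring
  -- closed-cell membership from coordinates
  have hcl : ∀ {x : (EuclideanSpace ℝ (Fin 3))}, x ∈ (unitCylinder : Set (EuclideanSpace ℝ (Fin 3))) →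
      x 2 ∈ Icc (0 : ℝ) L →
      x ∈ closure (cylinderCell L : Set (EuclideanSpace ℝ (Fin 3))) := fun hx hz =>
    mem_closure_cylinderCell hL (by simpa using hx) hz
  -- core: pairs with `x₂ ≤ y₂ ≤ x₂ + L`
  have core : ∀ x ∈ (unitCylinder : Set (EuclideanSpace ℝ (Fin 3))),
      ∀ y ∈ (unitCylinder : Set (EuclideanSpace ℝ (Fin 3))),
      x 2 ≤ y 2 → y 2 ≤ x 2 + L →
        edist (curl v x) (curl v y) ≤ 2 * M * edist x y ^ (1 / 2 : ℝ) := by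
    intro x hx y hy hxy hyx
    -- translate both points by `-⌊x₂/L⌋ L e_z`
    set k : ℤ := ⌊x 2 / L⌋ with hk
    set x' : (EuclideanSpace ℝ (Fin 3)) := x + (((-k : ℤ) : ℝ) * L) • ez with hx'
    set y' : (EuclideanSpace ℝ (Fin 3)) := y + (((-k : ℤ) : ℝ) * L) • ez with hy'
    have hkle : (k : ℝ) * L ≤ x 2 := by
      have h := Int.floor_le (x 2 / L)
      rw [← hk] at h
      calc (k : ℝ) * L ≤ x 2 / L * L := mul_le_mul_of_nonneg_right h hL.le
        _ = x 2 := div_mul_cancel₀ _ hL.ne'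
    have hklt : x 2 < (k : ℝ) * L + L := by
      have h := Int.lt_floor_add_one (x 2 / L)
      rw [← hk] at h
      calc x 2 = x 2 / L * L := (div_mul_cancel₀ _ hL.ne').symm
        _ < ((k : ℝ) + 1) * L := mul_lt_mul_of_pos_right h hL
        _ = (k : ℝ) * L + L := by ring
    have hx'2 : x' 2 = x 2 - (k : ℝ) * L := by
      rw [hx', apply_two_add_axialShift]; push_cast; ring
    have hy'2 : y' 2 = y 2 - (k : ℝ) * L := by
      rw [hy', apply_two_add_axialShift]; push_cast; ring
    have hx'U : x' ∈ (unitCylinder : Set (EuclideanSpace ℝ (Fin 3))) := add_axialShift_mem_unitCylinder hx _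
    have hy'U : y' ∈ (unitCylinder : Set (EuclideanSpace ℝ (Fin 3))) := add_axialShift_mem_unitCylinder hy _
    have hx'cl : x' ∈ closure (cylinderCell L : Set (EuclideanSpace ℝ (Fin 3))) :=
      hcl hx'U ⟨by rw [hx'2]; linarith, by rw [hx'2]; linarith⟩
    have hcx : curl v x = w x' := by rw [← hcurl x' hx'U, hx', hcper.add_int_mul (-k) x]
    have hcy : curl v y = w y' := by rw [← hcurl y' hy'U, hy', hcper.add_int_mul (-k) y]
    have hed : edist x' y' = edist x y := by rw [hx', hy', edist_add_right]
    rw [hcx, hcy, ← hed]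
    by_cases hcase : y' 2 ≤ L
    · -- both translated points lie in the closed cell
      have hy'cl : y' ∈ closure (cylinderCell L : Set (EuclideanSpace ℝ (Fin 3))) :=
        hcl hy'U ⟨by rw [hy'2]; linarith, hcase⟩
      calc edist (w x') (w y') ≤ M * edist x' y' ^ (1 / 2 : ℝ) := hcell x' hx'cl y' hy'cl
        _ ≤ 2 * M * edist x' y' ^ (1 / 2 : ℝ) := by
            rw [two_mul, add_mul]
            exact le_self_add
    · -- cut the segment at `z = L` and translate the upper piece down by one period
      rw [not_le] at hcase
      have hden : 0 < y' 2 - x' 2 := by rw [hx'2, hy'2]; linarith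
      set t : ℝ := (L - x' 2) / (y' 2 - x' 2) with ht
      have ht01 : t ∈ Icc (0 : ℝ) 1 := by
        refine ⟨div_nonneg (by rw [hx'2]; linarith) hden.le, ?_⟩
        rw [ht, div_le_one hden, hx'2, hy'2]
        linarith
      set m : (EuclideanSpace ℝ (Fin 3)) := x' + t • (y' - x') with hm
      have hm2 : m 2 = L := by
        have h1 : m 2 = x' 2 + t * (y' 2 - x' 2) := by
          simp only [hm, PiLp.add_apply, PiLp.smul_apply, PiLp.sub_apply, smul_eq_mul]
        rw [h1, ht, div_mul_cancel₀ _ hden.ne']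
        ring
      have hmU : m ∈ (unitCylinder : Set (EuclideanSpace ℝ (Fin 3))) :=
        convex_unitCylinder.add_smul_sub_mem hx'U hy'U ht01
      have hmcl : m ∈ closure (cylinderCell L : Set (EuclideanSpace ℝ (Fin 3))) :=
        hcl hmU ⟨by rw [hm2]; exact hL.le, by rw [hm2]⟩
      -- the upper piece, translated down
      set m₁ : (EuclideanSpace ℝ (Fin 3)) := m + (((-1 : ℤ) : ℝ) * L) • ez with hm₁
      set y₁ : (EuclideanSpace ℝ (Fin 3)) := y' + (((-1 : ℤ) : ℝ) * L) • ez with hy₁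
      have hm₁2 : m₁ 2 = 0 := by rw [hm₁, apply_two_add_axialShift, hm2]; push_cast; ring
      have hy₁2 : y₁ 2 = y' 2 - L := by rw [hy₁, apply_two_add_axialShift]; push_cast; ring
      have hm₁U : m₁ ∈ (unitCylinder : Set (EuclideanSpace ℝ (Fin 3))) := add_axialShift_mem_unitCylinder hmU _
      have hy₁U : y₁ ∈ (unitCylinder : Set (EuclideanSpace ℝ (Fin 3))) := add_axialShift_mem_unitCylinder hy'U _
      have hm₁cl : m₁ ∈ closure (cylinderCell L : Set (EuclideanSpace ℝ (Fin 3))) :=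
        hcl hm₁U ⟨by rw [hm₁2], by rw [hm₁2]; exact hL.le⟩
      have hy₁cl : y₁ ∈ closure (cylinderCell L : Set (EuclideanSpace ℝ (Fin 3))) :=
        hcl hy₁U ⟨by rw [hy₁2]; linarith, by rw [hy₁2, hy'2]; linarith⟩
      have hwm : w m = w m₁ := by
        rw [← hcurl m hmU, ← hcurl m₁ hm₁U, hm₁, hcper.add_int_mul (-1) m]
      have hwy : w y' = w y₁ := by
        rw [← hcurl y' hy'U, ← hcurl y₁ hy₁U, hy₁, hcper.add_int_mul (-1) y']
      have hed₁ : edist m₁ y₁ = edist m y' := by rw [hm₁, hy₁, edist_add_right]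
      obtain ⟨hseg₁, hseg₂⟩ := edist_segment_le (a := x') (b := y') ht01
      have hpow₁ : edist x' m ^ (1 / 2 : ℝ) ≤ edist x' y' ^ (1 / 2 : ℝ) :=
        ENNReal.rpow_le_rpow hseg₁ (by norm_num)
      have hpow₂ : edist m y' ^ (1 / 2 : ℝ) ≤ edist x' y' ^ (1 / 2 : ℝ) :=
        ENNReal.rpow_le_rpow hseg₂ (by norm_num)
      calc edist (w x') (w y') ≤ edist (w x') (w m) + edist (w m) (w y') := edist_triangle _ _ _
        _ = edist (w x') (w m) + edist (w m₁) (w y₁) := by rw [hwm, hwy]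
        _ ≤ M * edist x' m ^ (1 / 2 : ℝ) + M * edist m₁ y₁ ^ (1 / 2 : ℝ) :=
            add_le_add (hcell x' hx'cl m hmcl) (hcell m₁ hm₁cl y₁ hy₁cl)
        _ ≤ M * edist x' y' ^ (1 / 2 : ℝ) + M * edist x' y' ^ (1 / 2 : ℝ) := by
            rw [hed₁]
            exact add_le_add (mul_le_mul' le_rfl hpow₁) (mul_le_mul' le_rfl hpow₂)
        _ = 2 * M * edist x' y' ^ (1 / 2 : ℝ) := by ring
  -- all pairs: order the points by `z` and bring the upper one within a period
  have hcoe : (((2 * C₀.toNNReal) * n : ℝ≥0) : ℝ≥0∞) = 2 * M := by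
    rw [hM, ENNReal.coe_mul, ENNReal.coe_mul, ENNReal.coe_toNNReal hC₀top]
    push_cast
    ring
  have hr : ((1 / 2 : ℝ≥0) : ℝ) = 1 / 2 := by norm_num
  have ordered : ∀ x ∈ (unitCylinder : Set (EuclideanSpace ℝ (Fin 3))),
      ∀ y ∈ (unitCylinder : Set (EuclideanSpace ℝ (Fin 3))), x 2 ≤ y 2 →
      edist (curl v x) (curl v y) ≤ 2 * M * edist x y ^ (1 / 2 : ℝ) := by
    intro x hx y hy hxy
    set j : ℤ := ⌊(y 2 - x 2) / L⌋ with hj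
    have hj0 : (0 : ℝ) ≤ (j : ℝ) * L := by
      have : (0 : ℤ) ≤ j := by
        rw [hj]
        exact Int.floor_nonneg.2 (div_nonneg (sub_nonneg.2 hxy) hL.le)
      exact mul_nonneg (by exact_mod_cast this) hL.le
    have hjle : (j : ℝ) * L ≤ y 2 - x 2 := by
      have h := Int.floor_le ((y 2 - x 2) / L)
      rw [← hj] at h
      calc (j : ℝ) * L ≤ (y 2 - x 2) / L * L := mul_le_mul_of_nonneg_right h hL.le
        _ = y 2 - x 2 := div_mul_cancel₀ _ hL.ne'
    have hjlt : y 2 - x 2 < (j : ℝ) * L + L := by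
      have h := Int.lt_floor_add_one ((y 2 - x 2) / L)
      rw [← hj] at h
      calc y 2 - x 2 = (y 2 - x 2) / L * L := (div_mul_cancel₀ _ hL.ne').symm
        _ < ((j : ℝ) + 1) * L := mul_lt_mul_of_pos_right h hL
        _ = (j : ℝ) * L + L := by ring
    set y'' : (EuclideanSpace ℝ (Fin 3)) := y + (((-j : ℤ) : ℝ) * L) • ez with hy''
    have hy''2 : y'' 2 = y 2 - (j : ℝ) * L := by
      rw [hy'', apply_two_add_axialShift]; push_cast; ring
    have hy''U : y'' ∈ (unitCylinder : Set (EuclideanSpace ℝ (Fin 3))) := add_axialShift_mem_unitCylinder hy _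
    have hcy : curl v y = curl v y'' := by rw [hy'', hcper.add_int_mul (-j) y]
    have hdist : edist x y'' ≤ edist x y := by
      rw [edist_dist, edist_dist, dist_eq_norm, dist_eq_norm]
      refine ENNReal.ofReal_le_ofReal ?_
      have e1 : y'' = y + (-((j : ℝ) * L)) • ez := by rw [hy'']; push_cast; ring_nf
      rw [e1]
      exact norm_sub_add_axialShift_le hj0 hjle
    calc edist (curl v x) (curl v y) = edist (curl v x) (curl v y'') := by rw [hcy]
      _ ≤ 2 * M * edist x y'' ^ (1 / 2 : ℝ) :=
          core x hx y'' hy''U (by rw [hy''2]; linarith) (by rw [hy''2]; linarith)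
      _ ≤ 2 * M * edist x y ^ (1 / 2 : ℝ) :=
          mul_le_mul' le_rfl (ENNReal.rpow_le_rpow hdist (by norm_num))
  intro x hx y hy
  rw [hcoe, hr]
  rcases le_total (x 2) (y 2) with hxy | hyx
  · exact ordered x hx y hy hxy
  · rw [edist_comm (curl v x), edist_comm x]
    exact ordered y hy x hx hyx

end Literature.Analysis.FluidPDE
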